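import Literature.AlgebraicGeometry.Resolution.ProjectiveModelsDomination
import Literature.AlgebraicGeometry.Resolution.ProjectiveModelsCharts
import Literature.AlgebraicGeometry.Resolution.ProjectiveModelsFunctionField
import Literature.AlgebraicGeometry.Resolution.NormalizationInNormal
import Literature.AlgebraicGeometry.Resolution.NormalizationInExtensionGenericPoint
import Literature.AlgebraicGeometry.Motives.CyclesDimensionFunctionField
import HarnessLib

/-!
# `WildQuotients.SummitReduction` (stmt-ResolutionOfSingularities-16324), line `FramePerfect`, stub 1a:
# projective models with finite group actions — the function field, the base `k(x)` and `Y`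

Route `ResolutionOfSingularities/WildQuotients`, crux `SummitReduction`; helper file of stub
`stub_pair_equivariantFibration` (de Jong 1997, Lemma 5.2: "Let `X' → Y → P^{d-1}` be the Stein
factorization. Note that `G` acts on `Y` and that `X' → Y` and `Y → S` are `G`-equivariant"). In
the tree's language of projective models (`ProjModel`, Zariski–Samuel VI §17) this file provides:

* `exists_algEquivHom_functionField` — a `k`-linear action `ρ : G →* Aut X` induces
  `γ : G →* (K(X) ≃ₐ[k] K(X))` with `(γ g)⁻¹ = (ρ g)♯` (pull-back of rational functions);
* `nonempty_projModel_adjoin` — a finitely generated subfield `k(S) ⊆ K` has a projective model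
  (the projective closure of `Spec k[S]`);
* `exists_projModel_normalizationIn_equivariant` — for a projective model `M` of `F/k` and a
  finite extension `L/F` with a group `G` acting on `L` by `F`-automorphisms, the normalization
  `Y = M^L` of `M` in `L` is a projective model of `L/k` on which `G` acts by `k`-automorphisms
  compatibly with the generic point (`gen_Y ≫ ρY g = Spec((δ g)⁻¹) ≫ gen_Y`) — functoriality of
  Mathlib's relative normalization (`Scheme.Hom.normalizationDesc`, `normalization.hom_ext`).
-/

set_option linter.dupNamespace false

noncomputable section

open CategoryTheory CategoryTheory.Limits AlgebraicGeometry TopologicalSpace IsLocalRing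
open scoped TensorProduct

namespace Summit.ResolutionOfSingularities.ResolutionOfSingularities.Theorems

open Literature.AlgebraicGeometry.Resolution Literature.AlgebraicGeometry.Motives

universe u

/-! ## The action on the function field -/

/-- **A `k`-linear group action on an integral `k`-scheme acts on its function field by
`k`-algebra automorphisms.** For `ρ : G →* Aut X` with `ρ g ≫ f = f` there is
`γ : G →* (K(X) ≃ₐ[k] K(X))` with `(γ g)⁻¹ a = (ρ g)♯ a` (the pull-back
`RatFn.functionFieldMap`, which is contravariant: `(ρ g ρ h)♯ = (ρ h)♯ ∘ (ρ g)♯`), for any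
`k`-algebra structure on `K(X)` given by `k = Γ(Spec k) → Γ(X, 𝒪) → K(X)`. [folklore] -/
theorem exists_algEquivHom_functionField {k : Type u} [Field k] {X : Scheme.{u}} [IsIntegral X]
    (f : X ⟶ Spec (.of k)) [Algebra k X.functionField]
    (halg : ∀ c : k, algebraMap k X.functionField c =
      X.presheaf.germ ⊤ (genericPoint X) trivial (f.appTop ((Scheme.ΓSpecIso (.of k)).inv c)))
    {G : Type*} [Group G] (ρ : G →* Aut X) (hρ : ∀ g : G, (ρ g).hom ≫ f = f) :
    ∃ γ : G →* (X.functionField ≃ₐ[k] X.functionField),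
      ∀ (g : G) (a : X.functionField), (γ g).symm a = RatFn.functionFieldMap (ρ g).hom a := by
  classical
  -- `♯` depends only on the morphism
  have hcongr : ∀ (u v : X ⟶ X) [IsDominant u] [IsDominant v], u = v →
      RatFn.functionFieldMap u = RatFn.functionFieldMap v := by
    intro u v _ _ e
    subst e
    rfl
  have hcomp : ∀ g h : G, RatFn.functionFieldMap (ρ (g * h)).hom =
      (RatFn.functionFieldMap (ρ h).hom).comp (RatFn.functionFieldMap (ρ g).hom) := by
    intro g h
    rw [← RatFn.functionFieldMap_comp (ρ g).hom (ρ h).hom]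
    exact hcongr _ _ (by rw [map_mul]; rfl)
  have hone : RatFn.functionFieldMap (ρ 1).hom = RingHom.id _ := by
    rw [← RatFn.functionFieldMap_id (X := X)]
    exact hcongr _ _ (by rw [map_one]; rfl)
  have hlin : ∀ (g : G) (c : k), RatFn.functionFieldMap (ρ g).hom (algebraMap k X.functionField c) =
      algebraMap k X.functionField c := by
    intro g c
    rw [halg]
    exact functionFieldMap_algebraMap_top f (ρ g).hom f (hρ g) c
  let γ₀ : G → (X.functionField ≃ₐ[k] X.functionField) := fun g =>
    { toFun := RatFn.functionFieldMap (ρ g⁻¹).hom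
      invFun := RatFn.functionFieldMap (ρ g).hom
      left_inv := fun a => by
        change ((RatFn.functionFieldMap (ρ g).hom).comp (RatFn.functionFieldMap (ρ g⁻¹).hom)) a = a
        rw [← hcomp, inv_mul_cancel, hone]; rfl
      right_inv := fun a => by
        change ((RatFn.functionFieldMap (ρ g⁻¹).hom).comp (RatFn.functionFieldMap (ρ g).hom)) a = a
        rw [← hcomp, mul_inv_cancel, hone]; rfl
      map_mul' := map_mul _
      map_add' := map_add _
      commutes' := hlin g⁻¹ }
  refine ⟨{ toFun := γ₀, map_one' := ?_, map_mul' := ?_ }, fun g a => rfl⟩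
  · ext a
    change RatFn.functionFieldMap (ρ 1⁻¹).hom a = a
    rw [inv_one, hone]; rfl
  · intro g h
    ext a
    change RatFn.functionFieldMap (ρ (g * h)⁻¹).hom a =
      RatFn.functionFieldMap (ρ g⁻¹).hom (RatFn.functionFieldMap (ρ h⁻¹).hom a)
    rw [mul_inv_rev, hcomp]; rfl

/-! ## A projective model of `k(S)` -/

open scoped IntermediateField.algebraAdjoinAdjoin in
/-- **A finitely generated subfield `k(S) ⊆ K` has a projective model over `k`**: the projective
closure of the affine model `Spec k[S]` (`k[S]` is a finitely generated `k`-algebra with fraction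
field `k(S)`; the tree's `ProjModel.exists_regCentre_of_hasRegularCentre`, Zariski–Samuel VI §17).
[cite: ZariskiSamuel1960, Ch. VI §17] -/
theorem nonempty_projModel_adjoin {k K : Type u} [Field k] [Field K] [Algebra k K]
    (S : Finset K) : Nonempty (ProjModel k (IntermediateField.adjoin k (S : Set K))) := by
  classical
  set F : IntermediateField k K := IntermediateField.adjoin k (S : Set K) with hF
  let S' : Set F := ((↑) : F → K) ⁻¹' (S : Set K)
  have hS' : S'.Finite := (S.finite_toSet).preimage Subtype.val_injective.injOn
  let T : Subalgebra k F := Algebra.adjoin k S'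
  have hT : T.FG := Subalgebra.fg_def.mpr ⟨S', hS', rfl⟩
  have hTmap : T.map F.val = Algebra.adjoin k (S : Set K) := by
    rw [AlgHom.map_adjoin]
    congr 1
    ext z
    simp only [Set.mem_image, Set.mem_preimage, S', IntermediateField.coe_val, Finset.mem_coe]
    constructor
    · rintro ⟨a, ha, rfl⟩; exact ha
    · intro hz
      exact ⟨⟨z, IntermediateField.subset_adjoin k _ hz⟩, hz, rfl⟩
  haveI : IsFractionRing T F := by
    refine IsFractionRing.of_field T F fun z => ?_
    obtain ⟨r, hr, s, hs, hz⟩ := (IntermediateField.mem_adjoin_iff_div (F := k)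
      (S := (S : Set K))).mp z.2
    rw [← hTmap] at hr hs
    obtain ⟨r', hr', rfl⟩ := hr
    obtain ⟨s', hs', rfl⟩ := hs
    refine ⟨⟨r', hr'⟩, ⟨s', hs'⟩, Subtype.ext ?_⟩
    simpa using hz
  obtain ⟨M, -⟩ := ProjModel.exists_regCentre_of_hasRegularCentre T hT
  exact ⟨M⟩

/-! ## The normalization `Y = M^L` with its `G`-action -/

/-- **The normalization of a projective model in a finite extension with a group action.** Let
`M` be a projective model of `F/k`, `L/F` a finite extension and `δ : G →* (L ≃ₐ[F] L)` an action
by `F`-automorphisms. Then the normalization `Y = M^L` of `M` in `L` (Liu 2002, 4.1.24; finite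
over `M` by E. Noether, hence projective over `k`, the tree's `isProjectiveOver_normalizationIn`)
is a projective model of `L/k` with generic point `Spec L → Y`, and `G` acts on `Y` by
`k`-automorphisms `ρY` over `M` with `gen_Y ≫ ρY g = Spec((δ g)⁻¹) ≫ gen_Y`: `ρY g` is the
morphism `Y → Y` induced on relative normalizations by the automorphism `Spec((δ g)⁻¹)` of
`Spec L` over `M` (Mathlib's `Scheme.Hom.normalizationDesc`; the group law by the uniqueness
`Scheme.Hom.normalization.hom_ext`). This is "`G` acts on `Y`" in de Jong 1997, Lemma 5.2, with
`Y` the normalization of `P^{d-1}` rather than the Stein factorization.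
[cite: DeJong1997, Lemma 5.2 (proof), p. 613] -/
theorem exists_projModel_normalizationIn_equivariant {k F Lt : Type u} [Field k] [Field F]
    [Field Lt] [Algebra k F] [Algebra F Lt] [Algebra k Lt] [IsScalarTower k F Lt]
    [FiniteDimensional F Lt] (MF : ProjModel k F) {G : Type*} [Group G]
    (δ : G →* (Lt ≃ₐ[F] Lt)) :
    ∃ (MY : ProjModel k Lt) (ρY : G →* Aut MY.X),
      (∀ g : G, (ρY g).hom ≫ MY.π = MY.π) ∧
      (∀ g : G, MY.gen ≫ (ρY g).hom =
        Spec.map (CommRingCat.ofHom ((δ g).symm : Lt →+* Lt)) ≫ MY.gen) := by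
  classical
  -- `K(M) ≅ F → L`
  let e : MF.X.functionField ≃ₐ[k] F := MF.funFieldAlgEquiv
  letI algFL : Algebra MF.X.functionField Lt := ((algebraMap F Lt).comp (e : _ →+* F)).toAlgebra
  have halgFL : ∀ c, algebraMap MF.X.functionField Lt c = algebraMap F Lt (e c) := fun _ => rfl
  letI : Algebra F MF.X.functionField := (e.symm : F →+* MF.X.functionField).toAlgebra
  haveI : IsScalarTower F MF.X.functionField Lt := IsScalarTower.of_algebraMap_eq fun c => by
    rw [halgFL]
    exact congrArg (algebraMap F Lt) (e.apply_symm_apply c).symm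
  haveI : FiniteDimensional MF.X.functionField Lt := Module.Finite.of_restrictScalars_finite F _ _
  -- the normalization and its generic point
  let ξL := fromSpecExtension MF.X Lt
  let Y := ξL.normalization
  let ν : Y ⟶ MF.X := ξL.fromNormalization
  let genY : Spec (.of Lt) ⟶ Y := ξL.toNormalization
  have hgenν : genY ≫ ν = ξL := ξL.toNormalization_fromNormalization
  have hξπ : ξL ≫ MF.π = Spec.map (CommRingCat.ofHom (algebraMap k Lt)) := by
    change (Spec.map (CommRingCat.ofHom (algebraMap MF.X.functionField Lt)) ≫
      MF.X.fromSpecStalk (genericPoint MF.X)) ≫ MF.π = _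
    rw [Category.assoc, ProjModel.fromSpecStalk_genericPoint_π, ← Spec.map_comp,
      ← CommRingCat.ofHom_comp]
    congr 2
    ext c
    change algebraMap MF.X.functionField Lt (algebraMap k MF.X.functionField c) = algebraMap k Lt c
    rw [halgFL, AlgEquiv.commutes, ← IsScalarTower.algebraMap_apply]
  have hgenpt : genY (closedPoint Lt) = genericPoint Y := toNormalization_apply MF.X Lt _
  have hiso : IsIso (Scheme.stalkClosedPointTo genY) := by
    haveI : IsPreimmersion genY := isPreimmersion_toNormalization MF.X Lt
    have hfield : IsField (Y.presheaf.stalk (genY (closedPoint Lt))) := by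
      rw [hgenpt]; exact Field.toIsField Y.functionField
    letI := hfield.toField
    refine (ConcreteCategory.isIso_iff_bijective _).mpr ⟨(Scheme.stalkClosedPointTo genY).hom.injective, ?_⟩
    change Function.Surjective (genY.stalkMap (closedPoint Lt) ≫ (stalkClosedPointIso (.of Lt)).hom)
    exact (stalkClosedPointIso (.of Lt)).commRingCatIsoToRingEquiv.surjective.comp
      (genY.stalkMap_surjective _)
  let MY : ProjModel k Lt :=
    { X := Y
      π := ν ≫ MF.π
      gen := genY
      gen_π := by rw [← Category.assoc, hgenν, hξπ]
      isIntegral := inferInstance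
      isProjectiveOver := isProjectiveOver_normalizationIn Lt MF.π MF.isProjectiveOver
      genericPt_eq := hgenpt
      isIso_stalkClosedPointTo := hiso }
  -- the automorphisms `Spec((δ g)⁻¹)` of `Spec L` over `M`, and the induced maps on `Y`
  let sL : G → (Spec (.of Lt) ⟶ Spec (.of Lt)) := fun g =>
    Spec.map (CommRingCat.ofHom ((δ g).symm : Lt →+* Lt))
  have hsL : ∀ g, sL g ≫ ξL = ξL := by
    intro g
    change sL g ≫ Spec.map (CommRingCat.ofHom (algebraMap MF.X.functionField Lt)) ≫
      MF.X.fromSpecStalk (genericPoint MF.X) = _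
    rw [← Spec.map_comp_assoc, ← CommRingCat.ofHom_comp]
    congr 3
    ext c
    change (δ g).symm (algebraMap MF.X.functionField Lt c) = algebraMap MF.X.functionField Lt c
    rw [halgFL, AlgEquiv.commutes]
  have hsL_mul : ∀ g h, sL g ≫ sL h = sL (h * g) := by
    intro g h
    change Spec.map _ ≫ Spec.map _ = Spec.map _
    rw [← Spec.map_comp, ← CommRingCat.ofHom_comp]
    congr 2
    ext x
    change (δ g).symm ((δ h).symm x) = (δ (h * g)).symm x
    rw [map_mul]
    rfl
  have hsL_one : sL 1 = 𝟙 _ := by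
    change Spec.map (CommRingCat.ofHom ((δ 1).symm : Lt →+* Lt)) = 𝟙 _
    rw [map_one]
    change Spec.map (CommRingCat.ofHom (RingHom.id Lt)) = 𝟙 _
    rw [CommRingCat.ofHom_id]; exact Spec.map_id _
  let a : G → (Y ⟶ Y) := fun g =>
    ξL.normalizationDesc (sL g ≫ genY) ν (by rw [Category.assoc, hgenν, hsL])
  have ha_gen : ∀ g, genY ≫ a g = sL g ≫ genY := fun g =>
    ξL.toNormalization_normalizationDesc _ _ _
  have ha_ν : ∀ g, a g ≫ ν = ν := fun g => ξL.normalizationDesc_comp _ _ _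
  have ha_mul : ∀ g h, a g ≫ a h = a (h * g) := by
    intro g h
    refine Scheme.Hom.normalization.hom_ext _ _ _ ν ?_ ?_ ?_
    · change genY ≫ a g ≫ a h = genY ≫ a (h * g)
      rw [← Category.assoc, ha_gen, Category.assoc, ha_gen, ← Category.assoc, hsL_mul, ha_gen]
    · change (a g ≫ a h) ≫ ν = ν
      rw [Category.assoc, ha_ν, ha_ν]
    · exact ha_ν _
  have ha_one : a 1 = 𝟙 Y := by
    refine Scheme.Hom.normalization.hom_ext _ _ _ ν ?_ ?_ ?_
    · change genY ≫ a 1 = genY ≫ 𝟙 Y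
      rw [ha_gen, hsL_one, Category.id_comp, Category.comp_id]
    · exact ha_ν _
    · exact Category.id_comp ν
  let ρY : G →* Aut Y :=
    { toFun := fun g =>
        { hom := a g
          inv := a g⁻¹
          hom_inv_id := by rw [ha_mul, inv_mul_cancel, ha_one]
          inv_hom_id := by rw [ha_mul, mul_inv_cancel, ha_one] }
      map_one' := by ext; exact ha_one
      map_mul' := fun g h => by
        ext
        change a (g * h) = a h ≫ a g
        rw [ha_mul] }
  refine ⟨MY, ρY, fun g => ?_, fun g => ?_⟩
  · change a g ≫ ν ≫ MF.π = ν ≫ MF.π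
    rw [← Category.assoc, ha_ν]
  · exact ha_gen g

end Summit.ResolutionOfSingularities.ResolutionOfSingularities.Theorems

end
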